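import Summits.QuantumFields.YangMills.Theses.BalabanLadder
import Summits.QuantumFields.YangMills.Theorems.IR.DefectChainPriceDefs
import Summits.QuantumFields.YangMills.Theorems.IR.DefectChainDominationEngine
import Summits.QuantumFields.YangMills.Theorems.IR.DefectChainRarity
import HarnessLib

/-!
# Crux `IR` (stmt-QuantumFields-19354) — the BILL of the withdrawn line `defect-chain-price` (ym-ir-idea-3) as a tree theorem:
# `IR ⟸ PricedClustering` (one hypothesis; both supports S1, S3 discharged)

Helper module for item `stmt-QuantumFields-19354` (`--supports … --as helper`; it closes nothing).  Pooled prover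
ym-ir-line-pool-p3 (g13).  With S1 `ChainRarity` (`Theorems/IR/DefectChainRarity.lean`, `chainRarity_holds`) and S3
`DominationEngine` (`Theorems/IR/DefectChainDominationEngine.lean`, `DefectChainPrice.dominationEngine_holds`, p636154) both
tree theorems, the workfile's kernel-checked composition `IR_of : ChainRarity → PricedClustering → DominationEngine → IR`
(`Cruxes/IR/Lines/defect_chain_price.lean` §4, VERBATIM below as `IR_of`) leaves ONE hypothesis:

* `IR_of_pricedClustering : PricedClustering → Theses.BalabanLadder.IR` — the line's bill.  Bookkeeping: instantiate S2, take
  `p` from S1 at S2's `θ`, choose `β₃` with `p(β) < c₁θ/(2t)` beyond it, bound the annealed price `∫ t^{#bad} dμ ≤ e^{(t−1)p m}`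
  by S3, `(t−1)p m ≤ (c₁/2) a(β) n` (`price_affordable`), conclude `GapInUnits` with rate `c₁/2`.
* `pricedClustering_shape_of_gapInUnits` (VERBATIM §5 of the workfile) — format sanity: `GapInUnits` gives the priced inequality
  with `t = 1`, i.e. S2 is no stronger than the crux conclusion (this is why the line was STRUCK: S2 ⟺ IR modulo S1, S3 —
  and modulo nothing now).

HONEST FRAMING.  `PricedClustering` (S2) is the infrared wall of `BalabanLadder.IR` in annealed-priced format — crux-equivalent,
OPEN, no mechanism (ym-ir-crit-1∕2 STRIKE; idea-3 withdrawal 2026-08-27T23:49Z); this file records that the large-field ∕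
defect-chain side is priced away at the correlation scale for EVERY compact simple `G` and nothing more.  Nothing here bears on
`IR` (0/1), `IRcof`, confinement, a lattice gap or the Yang–Mills mass gap (Clay), which are NOT proved; `R4` closes only the
conditional finite-𝕋⁴ rung `BalabanLadder.UV`.
-/

set_option autoImplicit false

noncomputable section

open MeasureTheory Filter Topology
open Literature.MathematicalPhysics.QuantumFieldTheory Literature.MathematicalPhysics.QuantumLattice
open Summit.QuantumFields.YangMills.Cruxes.OSLegsFromFemtoAndGap.DlrCollarTransfer (GapInUnits LowerBounds)

namespace Summit.QuantumFields.YangMills.Cruxes.IR.DefectChain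

/-- S3 over the tree name `DominationEngine` (the engine file states it unfolded). -/
theorem dominationEngine_holds : DominationEngine :=
  DefectChainPrice.dominationEngine_holds

/-- Arithmetic of the engine: the annealed price is affordable against half the rate (VERBATIM §4 of the workfile). -/
theorem price_affordable {t p θ c₁ aβ : ℝ} {n m ℓ : ℕ} (ht : 1 ≤ t) (_hp : 0 ≤ p) (hθ : 0 < θ) (hc₁ : 0 < c₁)
    (ha : 0 < aβ) (hpε : p ≤ c₁ * θ / (2 * t)) (hℓ : θ / aβ ≤ ℓ) (hm : (m : ℝ) ≤ n / ℓ) :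
    (t - 1) * p * m ≤ c₁ / 2 * aβ * n := by
  have ht0 : 0 < t := by linarith
  have hℓ0 : (0 : ℝ) < ℓ := lt_of_lt_of_le (div_pos hθ ha) hℓ
  have hm' : (m : ℝ) ≤ n * aβ / θ := by
    calc (m : ℝ) ≤ n / ℓ := hm
      _ ≤ n / (θ / aβ) := by
          apply div_le_div_of_nonneg_left (by positivity) (div_pos hθ ha) hℓ
      _ = n * aβ / θ := by rw [div_div_eq_mul_div]
  calc (t - 1) * p * m ≤ (t - 1) * (c₁ * θ / (2 * t)) * (n * aβ / θ) := by
        gcongr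
    _ = (t - 1) / t * (c₁ / 2 * aβ * n) := by
        field_simp
    _ ≤ 1 * (c₁ / 2 * aβ * n) := by
        apply mul_le_mul_of_nonneg_right _ (by positivity)
        rw [div_le_one ht0]; linarith
    _ = c₁ / 2 * aβ * n := one_mul _

/-- **`IR_of`: the three stubs imply the ROUTE DECL `Theses.BalabanLadder.IR` by name** (VERBATIM §4 of the workfile, over the tree
constants): instantiate S2, take `p` from S1 at S2's `θ`, choose `β₃` with `p(β) < c₁θ/(2t)` beyond it, bound the annealed price by
S3 and `price_affordable`, and conclude `GapInUnits` with rate `c₁/2`. -/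
theorem IR_of (h₁ : ChainRarity) (h₂ : PricedClustering) (h₃ : DominationEngine) :
    Summit.QuantumFields.YangMills.Theses.BalabanLadder.IR := by
  intro G _ _ _ _ hG
  letI : MeasurableSpace G := borel G
  haveI : BorelSpace G := ⟨rfl⟩
  intro r a ha ha0 hlb
  obtain ⟨θ, t, c₁, β₂, S₁, hθ, ht, hc₁, hAB⟩ := h₂ G hG r a ha ha0 hlb
  obtain ⟨p, hp0, hpnn, hher⟩ := h₁ G hG r a ha ha0 θ hθ
  have ht0 : 0 < t := by linarith
  have hε : 0 < c₁ * θ / (2 * t) := by positivity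
  obtain ⟨β₃, hβ₃⟩ := Filter.eventually_atTop.1 (hp0.eventually (Iio_mem_nhds hε))
  refine ⟨c₁ / 2, max β₂ β₃, S₁, by positivity, fun A B => ?_⟩
  obtain ⟨C, hC0, hC⟩ := hAB A B
  refine ⟨C, fun β hβ S n hS hn => ?_⟩
  have hβ2 : β₂ ≤ β := le_trans (le_max_left _ _) hβ
  have hβ3 : β₃ ≤ β := le_trans (le_max_right _ _) hβ
  -- notation
  set ℓ : ℕ := scaleL a θ β with hℓdef
  set k : ℕ := chainK a β with hkdef
  set m : ℕ := n / ℓ with hmdef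
  set μ := wilsonMeasure (d := 4) (L := 2 * S + 1) r.ρ β with hμ
  haveI : IsProbabilityMeasure μ := isProbabilityMeasure_wilsonMeasure (d := 4) (L := 2 * S + 1) (G := G) r.ρ r.continuous β
  -- the coarse scale is at least `θ / a β`, and the boxes fit in the torus
  have hℓge : θ / a β ≤ (ℓ : ℝ) := Nat.le_ceil _
  have hℓpos : 0 < ℓ := Nat.ceil_pos.2 (div_pos hθ (ha β))
  have hmS : m * ℓ ≤ S := le_trans (Nat.div_mul_le_self n ℓ) hn
  have hmle : (m : ℝ) ≤ n / ℓ := Nat.cast_div_le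
  -- S3 applied to the bad boxes, fed by S1
  have hI : (∫ U, t ^ badCount r.ρ k ℓ m U ∂μ) ≤ Real.exp ((t - 1) * p β * m) := by
    have h := h₃ (GaugeConfig 4 (2 * S + 1) G) μ (fun j => badBox r.ρ k ℓ j) m (p β) t (hpnn β) ht
      (fun F hF => hher β S m hmS F hF)
    simpa [badCount] using h
  have hprice : (t - 1) * p β * m ≤ c₁ / 2 * a β * n :=
    price_affordable ht (hpnn β) hθ hc₁ (ha β) (hβ₃ β hβ3).le hℓge hmle
  have hmain := hC β hβ2 S n hS hn
  calc |latticeConnectedCorr r.ρ β (2 * S + 1) A.F B.F n|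
      ≤ C * (∫ U, t ^ badCount r.ρ k ℓ m U ∂μ) * Real.exp (-(c₁ * a β * n)) := hmain
    _ ≤ C * Real.exp ((t - 1) * p β * m) * Real.exp (-(c₁ * a β * n)) := by gcongr
    _ ≤ C * Real.exp (c₁ / 2 * a β * n) * Real.exp (-(c₁ * a β * n)) := by gcongr
    _ = C * Real.exp (-(c₁ / 2 * a β * n)) := by
        rw [mul_assoc, ← Real.exp_add]
        ring_nf

/-- **The bill of the line as a one-hypothesis theorem: `PricedClustering → IR`** (S1 := `chainRarity_holds`, S3 :=
`dominationEngine_holds`).  S2 is crux-equivalent and OPEN; no claim about `IR`. -/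
theorem IR_of_pricedClustering (h₂ : PricedClustering) : Summit.QuantumFields.YangMills.Theses.BalabanLadder.IR :=
  IR_of chainRarity_holds h₂ dominationEngine_holds

/-! ## Format sanity: the priced stub is WEAKER than the crux conclusion (`t = 1`) — VERBATIM §5 of the workfile -/

/-- `GapInUnits` implies the priced inequality with `t = 1` (no price): S2 is no stronger than `IR`'s conclusion. -/
theorem pricedClustering_shape_of_gapInUnits
    (G : Type) [Group G] [TopologicalSpace G] [IsTopologicalGroup G] [CompactSpace G]
    [MeasurableSpace G] [BorelSpace G] (r : LatticeRep G) (a : ℝ → ℝ) (θ : ℝ)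
    (h : GapInUnits G r a) :
    ∃ (t c₁ β₂ : ℝ) (S₁ : ℝ → ℕ), 1 ≤ t ∧ 0 < c₁ ∧
      ∀ A B : YMSpecies G, ∃ C : ℝ, ∀ β : ℝ, β₂ ≤ β → ∀ S n : ℕ, S₁ β ≤ S → n ≤ S →
        |latticeConnectedCorr r.ρ β (2 * S + 1) A.F B.F n| ≤
          C * (∫ U, t ^ badCount r.ρ (chainK a β) (scaleL a θ β) (n / scaleL a θ β) U
                ∂(wilsonMeasure (d := 4) (L := 2 * S + 1) r.ρ β)) * Real.exp (-(c₁ * a β * n)) := by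
  obtain ⟨c₁, β₂, S₁, hc₁, hAB⟩ := h
  refine ⟨1, c₁, β₂, S₁, le_rfl, hc₁, fun A B => ?_⟩
  obtain ⟨C, hC⟩ := hAB A B
  refine ⟨C, fun β hβ S n hS hn => ?_⟩
  haveI : IsProbabilityMeasure (wilsonMeasure (d := 4) (L := 2 * S + 1) r.ρ β) :=
    isProbabilityMeasure_wilsonMeasure (d := 4) (L := 2 * S + 1) (G := G) r.ρ r.continuous β
  simpa [one_pow] using hC β hβ S n hS hn

end Summit.QuantumFields.YangMills.Cruxes.IR.DefectChain

end
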